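import Summits.ABC.IUTFork.Thm311RealIsmDHMoverDeep
import Summits.ABC.IUTFork.Thm311RealIsmDHMoverBoundary
import HarnessLib

/-!
# [IUTchIII] Cor. 3.12, TEAM R `indFixes` thread: the CLASSIFICATION of the balls `t·𝒪_v` fixed by Dupuy–Hilado's
# (Ind2) at a place over an ODD prime — one `iff`

PROOF-ONLY file (0 definitions, 0 named facts) of the abc-iut cell (block C / W6 prover seat abc-iut-w6-d060,
gen 2; TEAM R «ismDH mover» record support); TAKES NO SIDE on [IUTchIII] Cor. 3.12.  It assembles, into ONE
citable equivalence, the kernel answers to «which balls `{‖y‖ ≤ ‖ϖ‖^j}` of `F_v` does EVERY element of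
`Real.ismDH logv (inr v)` map onto itself?» at a finite place `v | p`, `p` ODD (all by name):
* `2 ≤ p`, `e(v|p) ≤ p − 2` (tame; `e = 1` included): abc-iut-w5-d180 `forall_ismDH_image_closedBall_eq_iff_dvd`
  (p432150) — fixed iff `e ∣ j − 1`; there `F_v` has no `ζ_p ≠ 1` (abc-iut-w5-d039
  `forall_pow_prime_eq_one_of_not_pred_dvd`: `ζ_p ∈ F_v ⇒ (p − 1) ∣ e`);
* `e(v|p) = p − 1`: this seat's trichotomy (`Thm311RealIsmDHMoverBoundary`, p438915) — no `ζ_p`: iff `e ∣ j − 1`;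
  `ζ_p`, `f = 1`: iff `e ∣ j − 2`; `ζ_p`, `f ≥ 2`: never;
* `e(v|p) ≥ p`: this seat's deep theorem (`Thm311RealIsmDHMoverDeep`) — never.

RESULT `forall_ismDH_image_closedBall_eq_iff_of_odd`: for `p` odd, a uniformizer `ϖ` of `F_v` and `j ∈ ℤ`,
EVERY (Ind2)-element fixes `{‖y‖ ≤ ‖ϖ‖^j}` **iff**
  EITHER `F_v` has no non-trivial `p`-th root of unity, `e(v|p) ≤ p − 1` and `e(v|p) ∣ j − 1`,
  OR `F_v` has a non-trivial `p`-th root of unity, `e(v|p) = p − 1`, `f(v|p) = 1` and `e(v|p) ∣ j − 2`.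
Mover form `exists_mem_ismDH_image_closedBall_ne_iff_of_odd` (negation, for `t ≠ 0` of order `j`).

HONEST FRAMING.  A statement about Dupuy–Hilado's typed (Ind2) group on one-factor hull-sets; nothing about which
reading of [IUTchIII] Thm. 3.11 (i) (Ind2) is print's or about Cor. 3.12.  [cite: DupuyHilado2025, §4.9]
[cite: WeilBNT1967, Ch. II §2, Th. 1–2] [cite: NeukirchANT1999, Ch. II Prop. (5.5)–(5.7), (7.13)]
[claim: Mochizuki2012, status: disputed] for every [IUTchIII]/[IUTchIV] locution.
-/

noncomputable section

open Metric Set NumberField IsDedekindDomain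
open scoped Pointwise

namespace Summit.ABC.IUTFork.Thm311.Real

open Cor312Vol Literature.IUT.LogThetaLattice Literature.IUT.LogVolume Literature.NumberTheory.NumberFields
open Literature.NumberTheory.GaloisRepresentations.Ultrametric

variable {F : Type} [Field F] [NumberField F] {p : ℕ} [hp : Fact p.Prime]
variable {logv : PadicLogs F} (hlog : LogvAnalyticAt p logv)
variable {v : HeightOneSpectrum (𝓞 F)} {hv : ((p : ℕ) : 𝓞 F) ∈ v.asIdeal}
include hlog

/-- **CLASSIFICATION OF (Ind2)-FIXED BALLS OVER AN ODD PRIME.**  At a finite place `v | p`, `p` odd, for a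
uniformizer `ϖ` of `F_v` and `j ∈ ℤ`: every element of `Real.ismDH logv (inr v)` maps `{‖y‖ ≤ ‖ϖ‖^j}` onto itself
iff EITHER (`F_v` has no `ζ_p ≠ 1`, `e(v|p) ≤ p − 1`, `e(v|p) ∣ j − 1`) OR (`F_v ∋ ζ_p ≠ 1`, `e(v|p) = p − 1`,
`f(v|p) = 1`, `e(v|p) ∣ j − 2`).  [cite: DupuyHilado2025, §4.9] [cite: WeilBNT1967, Ch. II §2, Th. 1–2]
[cite: NeukirchANT1999, Ch. II Prop. (5.5)–(5.7), (7.13)] -/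
theorem forall_ismDH_image_closedBall_eq_iff_of_odd (hp2 : p ≠ 2) {ϖ : (RescaledCompletion F p v hv)ˣ}
    (hϖ : IsUniformizer ϖ) (j : ℤ) :
    (∀ g ∈ ismDH logv (.inr v),
        (fun a => toR p v hv (g (ofR p v hv a))) ''
            closedBall (0 : RescaledCompletion F p v hv) ‖(ϖ : RescaledCompletion F p v hv) ^ j‖ =
          closedBall 0 ‖(ϖ : RescaledCompletion F p v hv) ^ j‖) ↔
      ((∀ ζ : RescaledCompletion F p v hv, ζ ^ p = 1 → ζ = 1) ∧ v.asIdeal.ramificationIdx ℤ ≤ p - 1 ∧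
          ((v.asIdeal.ramificationIdx ℤ : ℕ) : ℤ) ∣ (j - 1)) ∨
        ((∃ ζ : RescaledCompletion F p v hv, ζ ^ p = 1 ∧ ζ ≠ 1) ∧ v.asIdeal.ramificationIdx ℤ = p - 1 ∧
          v.asIdeal.inertiaDeg ℤ = 1 ∧ ((v.asIdeal.ramificationIdx ℤ : ℕ) : ℤ) ∣ (j - 2)) := by
  set K := RescaledCompletion F p v hv
  set e := v.asIdeal.ramificationIdx ℤ with he_def
  have hp3 : 3 ≤ p := by have := hp.out.two_le; omega
  have hp2' : 2 < p := by omega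
  have heK : absRamificationIdx p K = e := absRamificationIdx_rescaledCompletion F p v hv
  rcases Nat.lt_or_ge e (p - 1) with hlt | hge
  · -- TAME: `e ≤ p − 2`; no `ζ_p` in `K` since `(p − 1) ∤ e`
    have he2 : e ≤ p - 2 := by omega
    have hepos : 0 < e := by have := absRamificationIdx_pos p K; rwa [heK] at this
    have hnd : ¬ (p - 1) ∣ absRamificationIdx p K := by
      rw [heK]; intro hd; exact absurd (Nat.le_of_dvd hepos hd) (by omega)
    have hμ : ∀ ζ : K, ζ ^ p = 1 → ζ = 1 := forall_pow_prime_eq_one_of_not_pred_dvd p K hnd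
    rw [forall_ismDH_image_closedBall_eq_iff_dvd hlog hp2' he2 hϖ j]
    constructor
    · intro h; exact Or.inl ⟨hμ, by omega, h⟩
    · rintro (⟨-, -, h⟩ | ⟨⟨ζ, hζ, hζ1⟩, -, -, -⟩)
      · exact h
      · exact absurd (hμ ζ hζ) hζ1
  rcases hge.eq_or_lt with heq | hgt
  · -- BOUNDARY: `e = p − 1`
    have he : e = p - 1 := heq.symm
    by_cases hμ : ∀ ζ : K, ζ ^ p = 1 → ζ = 1
    · rw [forall_ismDH_image_closedBall_eq_iff_dvd_of_boundary hlog hp2 he hϖ hμ j]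
      constructor
      · intro h; exact Or.inl ⟨hμ, by omega, h⟩
      · rintro (⟨-, -, h⟩ | ⟨⟨ζ, hζ, hζ1⟩, -, -, -⟩)
        · exact h
        · exact absurd (hμ ζ hζ) hζ1
    · push Not at hμ
      obtain ⟨ζ, hζ, hζ1⟩ := hμ
      by_cases hf : v.asIdeal.inertiaDeg ℤ = 1
      · rw [forall_ismDH_image_closedBall_eq_iff_dvd_two_of_boundary hlog hp2 he hf hϖ hζ hζ1 j]
        constructor
        · intro h; exact Or.inr ⟨⟨ζ, hζ, hζ1⟩, he, hf, h⟩
        · rintro (⟨hμ', -, -⟩ | ⟨-, -, -, h⟩)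
          · exact absurd (hμ' ζ hζ) hζ1
          · exact h
      · have hf2 : 2 ≤ v.asIdeal.inertiaDeg ℤ := by
          have := residueDegree_pos p K
          rw [residueDegree_rescaledCompletion] at this
          omega
        constructor
        · intro h
          exfalso
          obtain ⟨g, hg, hne⟩ := exists_mem_ismDH_image_closedBall_ne_of_boundary_of_two_le_inertiaDeg hlog hp2
            he hf2 hζ hζ1 (t := (ϖ : K) ^ j) (zpow_ne_zero _ ϖ.ne_zero)
          exact hne (h g hg)
        · rintro (⟨hμ', -, -⟩ | ⟨-, -, hf1, -⟩)
          · exact absurd (hμ' ζ hζ) hζ1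
          · exact absurd hf1 hf
  · -- DEEP: `e ≥ p`
    have hpe : p ≤ e := by omega
    constructor
    · intro h
      exfalso
      obtain ⟨g, hg, hne⟩ := exists_mem_ismDH_image_closedBall_ne_of_prime_le_ramificationIdx hlog hp3 hpe
        (t := (ϖ : K) ^ j) (zpow_ne_zero _ ϖ.ne_zero)
      exact hne (h g hg)
    · rintro (⟨-, hle, -⟩ | ⟨-, heq, -, -⟩)
      · exfalso; omega
      · exfalso; omega

/-- **Mover form of the classification**: for `t ≠ 0` of order `j` (`‖t‖ = ‖ϖ‖^j`) at a place over an odd prime,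
SOME (Ind2)-element moves `t·𝒪_v` iff NOT [ (no `ζ_p`, `e ≤ p − 1`, `e ∣ j − 1`) or (`ζ_p`, `e = p − 1`, `f = 1`,
`e ∣ j − 2`) ]. [cite: DupuyHilado2025, §4.9] [cite: WeilBNT1967, Ch. II §2, Th. 1–2] -/
theorem exists_mem_ismDH_image_closedBall_ne_iff_of_odd (hp2 : p ≠ 2) {ϖ : (RescaledCompletion F p v hv)ˣ}
    (hϖ : IsUniformizer ϖ) {t : RescaledCompletion F p v hv} {j : ℤ}
    (ht : ‖t‖ = ‖(ϖ : RescaledCompletion F p v hv)‖ ^ j) :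
    (∃ g ∈ ismDH logv (.inr v),
        (fun a => toR p v hv (g (ofR p v hv a))) '' closedBall (0 : RescaledCompletion F p v hv) ‖t‖ ≠
          closedBall 0 ‖t‖) ↔
      ¬ (((∀ ζ : RescaledCompletion F p v hv, ζ ^ p = 1 → ζ = 1) ∧ v.asIdeal.ramificationIdx ℤ ≤ p - 1 ∧
            ((v.asIdeal.ramificationIdx ℤ : ℕ) : ℤ) ∣ (j - 1)) ∨
          ((∃ ζ : RescaledCompletion F p v hv, ζ ^ p = 1 ∧ ζ ≠ 1) ∧ v.asIdeal.ramificationIdx ℤ = p - 1 ∧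
            v.asIdeal.inertiaDeg ℤ = 1 ∧ ((v.asIdeal.ramificationIdx ℤ : ℕ) : ℤ) ∣ (j - 2))) := by
  rw [← forall_ismDH_image_closedBall_eq_iff_of_odd hlog hp2 hϖ j, ht, ← norm_zpow]
  constructor
  · rintro ⟨g, hg, hne⟩ h; exact hne (h g hg)
  · intro h; by_contra hc; push Not at hc; exact h hc

end Summit.ABC.IUTFork.Thm311.Real

end
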